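import Literature.AlgebraicGeometry.Frobenioids.UnitTrivializationModelType
import Literature.AlgebraicGeometry.Frobenioids.BiratLocalization
import Literature.AlgebraicGeometry.Frobenioids.ArithmeticFrobenioidStandard
import Literature.AlgebraicGeometry.Frobenioids.PadicFrobenioidCZeroGalois
import HarnessLib

/-!
# Frobenioids I, Theorem 5.1 (iv) "Moreover, `C` is of model type" AS TYPED (`PreFrobenioid.Thm51iv_modelType`):
# at THE birationalization of every Frobenioid, at the unit-trivialization `C^un-tr` (its printed consumer,
# Prop. 5.5 (iii)), and HYPOTHESIS-FREE at the genuine carriers `C_{K/F}` and `C₀(p)`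

Mochizuki, *The geometry of Frobenioids I: the general theory*, Kyushu J. Math. **62** (2008) 293–400, §5,
Theorem 5.1 (iv) p. 97 ("Suppose that `C` is of unit-trivial type. Then … Moreover, `C` is of model type"), proof
p. 100 ll. 2–5; consumed in print by Proposition 5.5 (iii) p. 105 ll. 9–11 ("`C^un-tr` … of model type [by
Theorem 5.1 (iv)]") [cite: MochizukiFrdI2008, Thm. 5.1 (iv) p.97] [cite: MochizukiFrdI2008, Prop. 5.5 (iii) p.104];
the carriers: `C_{K/F}` of Example 6.3 / Theorem 6.4 (i) [cite: MochizukiFrdI2008, Thm. 6.4 (i) p.114] and THE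
`p`-adic Frobenioid `C₀(p)` of Mochizuki, *The geometry of Frobenioids II*, Example 1.1 (i)
[cite: MochizukiFrdII2008, Ex 1.1 (i) p.7].

PROOF-ONLY file (abc-iut cell, D-0079 L-F [FrdI/II] sub-cell, LF-FRD row F-1071 `PreFrobenioid.Thm51iv_modelType`;
seat abc-iut-L1-t14), 0 definitions. The named statement of seat abc-iut-L1-t5 (`DivisorialDescriptionsSections.lean`)
is a SCHEMA in the birationalization datum `B` (never to be quantified universally; refuted as a closure in
`Thm51ivModelTypeSchemaNegative.lean`); its closer of record at THE birationalization is abc-iut-L1-t10's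
`PreFrobenioid.thm51iv_modelType_biratData F hF₀ hsq` (`UnitTrivialModelType.lean`). Here:

* the birat-squares binder `hsq` is discharged for every Frobenioid (`hasBiratSquares_of_isFrobenioid`):
  `thm51iv_modelType_biratData_of_isFrobenioid` — input "`C` is a Frobenioid" only;
* the statement at the unit-trivialization `C^un-tr → F_Φ` of a Frobenioid (`untrFunctor hF`) and THE
  birationalization of `C^un-tr` (`thm51iv_modelType_untr`) — the instance print consumes (Prop. 5.5 (iii)), at
  which all three antecedents of the typed statement HOLD (`isFrobenioid_untr`, `isOfIsotropicType_untr`,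
  `isOfUnitTrivialType_untr`, seats abc-iut-L1-d5/L6), so that the instance is not vacuous
  (`thm51iv_modelType_untr_nonvacuous`);
* both forms HYPOTHESIS-FREE at `C_{K/F}` (`arithFrobenioid_isFrobenioid`) and at THE `C₀(p)`
  (`PadicFrd.czeroGal_isFrobenioid`).

No statement of either paper is restated or strengthened; nothing here bears on, or takes a side on,
[IUTchIII] Cor. 3.12.
-/

noncomputable section

namespace Literature.AlgebraicGeometry.Frobenioids

open CategoryTheory Opposite

universe w v v' u u'

namespace PreFrobenioid

variable {D : Type u} [Category.{v} D] {Φ : Dᵒᵖ ⥤ CommMonCat.{w}} {C : Type u'} [Category.{v'} C]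
  {F : C ⥤ ElemFrobenioid Φ}

/-- **[FrdI] Thm. 5.1 (iv) "Moreover, `C` is of model type"** AS TYPED (`Thm51iv_modelType`) at THE
birationalization of a Frobenioid `F : C ⥤ F_Φ`, with the only input "`C` is a Frobenioid" (the composition
squares of Prop. 4.4 (i) exist in every Frobenioid, `hasBiratSquares_of_isFrobenioid`).
[cite: MochizukiFrdI2008, Thm. 5.1 (iv) p.97] -/
theorem thm51iv_modelType_biratData_of_isFrobenioid (hF : IsFrobenioid F) :
    Thm51iv_modelType F (biratData hF (hasBiratSquares_of_isFrobenioid hF)) :=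
  thm51iv_modelType_biratData F hF (hasBiratSquares_of_isFrobenioid hF)

/-- **[FrdI] Thm. 5.1 (iv) AS TYPED at the unit-trivialization `C^un-tr` of a Frobenioid** (the Frobenioid
`untrFunctor hF : C^un-tr ⥤ F_Φ`, Prop. 5.3) and THE birationalization of `C^un-tr` — the instance consumed in
print by Prop. 5.5 (iii) ("`C^un-tr` … of model type"). [cite: MochizukiFrdI2008, Thm. 5.1 (iv) p.97]
[cite: MochizukiFrdI2008, Prop. 5.5 (iii) p.104] -/
theorem thm51iv_modelType_untr (hF : IsFrobenioid F) :
    Thm51iv_modelType (untrFunctor hF) (biratData (isFrobenioid_untr hF) (hasBiratSquares_untr hF)) :=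
  thm51iv_modelType_biratData (untrFunctor hF) (isFrobenioid_untr hF) (hasBiratSquares_untr hF)

/-- The instance at `C^un-tr` is NOT vacuous: all three antecedents of the typed Thm. 5.1 (iv) hold there —
`C^un-tr` is a Frobenioid (Prop. 5.3), of isotropic type and of unit-trivial type (Prop. 5.5 (iii)) — so the
typed statement yields its conclusion outright: `C^un-tr` is of pre-model type and THE birationalization of
`C^un-tr` is of birationally Frobenius-normalized type (Def. 4.5 (i) "model type").
[cite: MochizukiFrdI2008, Thm. 5.1 (iv) p.97] [cite: MochizukiFrdI2008, Prop. 5.5 (iii) p.104] -/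
theorem thm51iv_modelType_untr_nonvacuous (hF : IsFrobenioid F) :
    IsOfPreModelType (untrFunctor hF) ∧
      PreFrobenioidData.IsOfBiratFrobeniusNormalizedType
        (biratData (isFrobenioid_untr hF) (hasBiratSquares_untr hF)) :=
  thm51iv_modelType_untr hF (isFrobenioid_untr hF) (isOfIsotropicType_untr hF) (isOfUnitTrivialType_untr hF)

end PreFrobenioid

/-! ### At the arithmetic Frobenioid `C_{K/F}` of [FrdI] Example 6.3 — nothing assumed -/

section Arith

variable (F : Type) [Field F] [NumberField F] (K : Type) [Field K] [Algebra F K] [IsGalois F K]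

/-- **[FrdI] Thm. 5.1 (iv) AS TYPED at `C_{K/F}` and THE birationalization of `C_{K/F}`**, hypothesis-free
(`C_{K/F}` is a Frobenioid, Thm. 6.4). [cite: MochizukiFrdI2008, Thm. 5.1 (iv) p.97] -/
theorem thm51iv_modelType_arith :
    PreFrobenioid.Thm51iv_modelType
      (ModelFrobenioid.toElem (arithDivisorFunctor F K) (unitsFunctor F K) (divNatTrans F K))
      (PreFrobenioid.biratData (arithFrobenioid_isFrobenioid F K)
        (PreFrobenioid.hasBiratSquares_of_isFrobenioid (arithFrobenioid_isFrobenioid F K))) :=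
  PreFrobenioid.thm51iv_modelType_biratData_of_isFrobenioid (arithFrobenioid_isFrobenioid F K)

/-- **[FrdI] Thm. 5.1 (iv) AS TYPED at the unit-trivialization `C_{K/F}^un-tr`** (where it is consumed: all
three antecedents hold, `PreFrobenioid.thm51iv_modelType_untr_nonvacuous`), hypothesis-free.
[cite: MochizukiFrdI2008, Thm. 5.1 (iv) p.97] [cite: MochizukiFrdI2008, Thm. 6.4 (i) p.115] -/
theorem thm51iv_modelType_untr_arith :
    PreFrobenioid.Thm51iv_modelType (PreFrobenioid.untrFunctor (arithFrobenioid_isFrobenioid F K))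
      (PreFrobenioid.biratData (PreFrobenioid.isFrobenioid_untr (arithFrobenioid_isFrobenioid F K))
        (PreFrobenioid.hasBiratSquares_untr (arithFrobenioid_isFrobenioid F K))) :=
  PreFrobenioid.thm51iv_modelType_untr (arithFrobenioid_isFrobenioid F K)

end Arith

/-! ### At THE `p`-adic Frobenioid `C₀(p)` of [FrdII] Example 1.1 (i) — nothing assumed -/

namespace PadicFrd

variable (p : ℕ) [Fact p.Prime]

/-- **[FrdI] Thm. 5.1 (iv) AS TYPED at THE `C₀(p)` and THE birationalization of `C₀(p)`**, hypothesis-free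
(`C₀` is a Frobenioid, [FrdII] Ex. 1.1 (i) / [FrdI] Thm. 5.2 (ii)). [cite: MochizukiFrdI2008, Thm. 5.1 (iv) p.97]
[cite: MochizukiFrdII2008, Ex 1.1 (i) p.7] -/
theorem thm51iv_modelType_czeroGal :
    PreFrobenioid.Thm51iv_modelType (Datum.zeroGal p).structureFunctor
      (PreFrobenioid.biratData (czeroGal_isFrobenioid p)
        (PreFrobenioid.hasBiratSquares_of_isFrobenioid (czeroGal_isFrobenioid p))) :=
  PreFrobenioid.thm51iv_modelType_biratData_of_isFrobenioid (czeroGal_isFrobenioid p)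

/-- **[FrdI] Thm. 5.1 (iv) AS TYPED at the unit-trivialization `C₀(p)^un-tr`** (all three antecedents hold,
`PreFrobenioid.thm51iv_modelType_untr_nonvacuous`), hypothesis-free. [cite: MochizukiFrdI2008, Thm. 5.1 (iv) p.97]
[cite: MochizukiFrdII2008, Ex 1.1 (i) p.7] -/
theorem thm51iv_modelType_untr_czeroGal :
    PreFrobenioid.Thm51iv_modelType (PreFrobenioid.untrFunctor (czeroGal_isFrobenioid p))
      (PreFrobenioid.biratData (PreFrobenioid.isFrobenioid_untr (czeroGal_isFrobenioid p))
        (PreFrobenioid.hasBiratSquares_untr (czeroGal_isFrobenioid p))) :=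
  PreFrobenioid.thm51iv_modelType_untr (czeroGal_isFrobenioid p)

end PadicFrd

end Literature.AlgebraicGeometry.Frobenioids

end
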